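import Mathlib
import HarnessLib
import Literature.Analysis.FluidPDE.Tao2016AveragedNS.TaylorChainCertificate
import Summits.NavierStokesRegularity.NavierStokesRegularity.Theorems.TaylorModelRungThreeReadoutChainMajorant
import Summits.NavierStokesRegularity.NavierStokesRegularity.Theorems.TaylorModelRungThreeReadoutG4Family
import Summits.NavierStokesRegularity.NavierStokesRegularity.Theorems.TaylorModelRungThreeReadoutG4Slope

/-!
# Line `taylor-model` on crux K1b-DR (stmt-NavierStokesRegularity-23954) — stub G4 (`LandingC1`),
# helper 6: the rP-unit frame transport — a BOUND on the σ-derivatives of the frozen-time flow maps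
# along the entry segment (G-PROOFPLAN §3, "the invariant")

Toward the registered stub `stub_landing : LandingC1`. Given the derivative witnesses `D σ t` of
`σ ↦ toVec (stAt φ j (seg σ) t)` within `[0,1]` (they EXIST by `exists_segDeriv`, helper 4), this file bounds
them in the certificate's units:

* `node_inBall` — the trajectory of a polytope point sits at node `u` in `x u + Ball(ρ u) ⊂ x u + Ball(ρO u)`
  (node invariant C2 + parallelepiped clause);
* `segDeriv_zero` — `D σ 0 = toVec (q − x 0)`, hence `∈ Ball(dm)`;
* `segDeriv_step` — across a full sub-step `u`: `D σ (Tn (u+1)) = Vap u h (D σ (Tn u)) + R` with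
  `R ∈ Ball((RemV + defect) · wn (D σ (Tn u)))` (two-point clause F5c on the increments + `deriv_bound_of_increment_bound`);
(the induction over the nodes — `frame_invariant`, `transport_bound` — is in the sequel `…G4TransportBound`).

MODEL-lattice bookkeeping only (rung TL-M3); nothing here is a statement about the Navier–Stokes equations.
-/

noncomputable section

-- the sub-problem namespace repeats the summit name by design (D-0017)
set_option linter.dupNamespace false

namespace Summit.NavierStokesRegularity.NavierStokesRegularity.Theorems.TaylorModelReadout.G4

open scoped BigOperators Topology
open Set Filter Literature.Analysis.FluidPDE.TaoCascade Literature.Analysis.FluidPDE.TaoCascade.TaylorChain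

variable {cd : CertData} {φ : Flow} {j : ℕ}

/-! ### A linear map of shell states read on window coordinates -/

variable (cd) in
/-- A linear self-map of shell states with window-supported values, read on window coordinates, as a
continuous linear map of `Fin (nW cd) → ℝ`. [folklore] -/
def winCLM (g : (Fin 4 → ℤ → ℝ) → (Fin 4 → ℤ → ℝ)) (hg : IsLinearMap ℝ g) :
    (Fin (nW cd) → ℝ) →L[ℝ] (Fin (nW cd) → ℝ) :=
  LinearMap.toContinuousLinearMap
    { toFun := fun x => toVec cd (g (ofVec cd x))
      map_add' := fun x y => by simp only [ofVec_add, hg.map_add, toVec_add]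
      map_smul' := fun r x => by simp only [ofVec_smul, hg.map_smul, toVec_smul, RingHom.id_apply] }

/-- `winCLM g x = toVec (g (ofVec x))`. [folklore] -/
@[simp] theorem winCLM_apply (g : (Fin 4 → ℤ → ℝ) → (Fin 4 → ℤ → ℝ)) (hg : IsLinearMap ℝ g)
    (x : Fin (nW cd) → ℝ) : winCLM cd g hg x = toVec cd (g (ofVec cd x)) := rfl

/-! ### Node positions of polytope trajectories -/

/-- At node `u` the trajectory of a polytope point lies in `x u + Ball(ρ u)` (node invariant C2 and the
parallelepiped clause). [folklore] -/
theorem node_inBall (hV : cd.Valid) (hj : j ≤ cd.N₀) (hC : ChainEnclosure cd φ) {q : Fin 4 → ℤ → ℝ}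
    (hq : InPoly cd j q) {u : ℕ} (hu : u ≤ cd.S j) :
    cd.InBall j (stAt φ j q (cd.Tn j u) - cd.x j u) (cd.ρ j u) := by
  obtain ⟨ξ, e, h1, h2, -⟩ := (hC j hj q hq).2.1 u hu
  have hpar := (G3.para_inBall hV hj hu ξ (fun i k hk1 hk2 => (h1 i k hk1 hk2).1)).1
  intro i k hk1 hk2
  have hnode := (h1 i k hk1 hk2).2
  have hval : (stAt φ j q (cd.Tn j u) - cd.x j u) i k = (cd.Cm j u ξ + e) i k := by
    simp only [Pi.sub_apply, Pi.add_apply, stAt, hnode]; ring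
  rw [hval]
  have h := inBall_add hpar h2 i k hk1 hk2
  simpa using h

/-- At node `u` the trajectory of a polytope point lies in `x u + Ball(ρO u)`. [folklore] -/
theorem node_inBall_ρO (hV : cd.Valid) (hj : j ≤ cd.N₀) (hC : ChainEnclosure cd φ) {q : Fin 4 → ℤ → ℝ}
    (hq : InPoly cd j q) {u : ℕ} (hu : u ≤ cd.S j) :
    cd.InBall j (stAt φ j q (cd.Tn j u) - cd.x j u) (cd.ρO j u) :=
  inBall_mono (G3.omega_pos hV hj) (node_inBall hV hj hC hq hu) (ρ_le_ρO hV hj hu)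

/-! ### The derivative witnesses along the entry segment -/

section Deriv

variable {q : Fin 4 → ℤ → ℝ} {D : ℝ → ℝ → (Fin (nW cd) → ℝ)} {σ : ℝ}

/-- At time `0` the σ-derivative of the flow along the segment is the segment direction `q − x 0`. [folklore] -/
theorem segDeriv_zero (hj : j ≤ cd.N₀) (hV : cd.Valid) (hC : ChainEnclosure cd φ) (hq : InPoly cd j q)
    (hD : ∀ σ ∈ Icc (0:ℝ) 1, ∀ t ∈ Icc 0 (cd.Tn j (cd.S j)),
      HasDerivWithinAt (fun σ' => toVec cd (stAt φ j (seg cd j q σ') t)) (D σ t) (Icc 0 1) σ)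
    (hσ : σ ∈ Icc (0:ℝ) 1) : D σ 0 = toVec cd (q - cd.x j 0) := by
  have hT : 0 ≤ cd.Tn j (cd.S j) := G3.Tn_nonneg hV hj le_rfl
  have h0 := hD σ hσ 0 ⟨le_rfl, hT⟩
  have h1 : HasDerivWithinAt (fun σ' => toVec cd (stAt φ j (seg cd j q σ') 0)) (toVec cd (q - cd.x j 0))
      (Icc 0 1) σ := by
    refine (hasDerivWithinAt_toVec_seg q (Icc 0 1) σ).congr_of_mem (fun σ' hσ' => ?_) hσ
    exact toVec_stAt_zero ((hC j hj _ (inPoly_seg (inPoly_x0 hV hj) hq hσ')).1)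
  exact (uniqueDiffOn_Icc zero_lt_one σ hσ).eq_deriv _ h0 h1

/-- The derivative witness at time `0` lies in `Ball(dm)`. [folklore] -/
theorem inBall_segDeriv_zero (hj : j ≤ cd.N₀) (hV : cd.Valid) (hC : ChainEnclosure cd φ) (hq : InPoly cd j q)
    (hD : ∀ σ ∈ Icc (0:ℝ) 1, ∀ t ∈ Icc 0 (cd.Tn j (cd.S j)),
      HasDerivWithinAt (fun σ' => toVec cd (stAt φ j (seg cd j q σ') t)) (D σ t) (Icc 0 1) σ)
    (hσ : σ ∈ Icc (0:ℝ) 1) : cd.InBall j (ofVec cd (D σ 0)) (cd.dm j) := by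
  rw [segDeriv_zero hj hV hC hq hD hσ, ofVec_toVec, inBall_trunc_iff]
  exact inBall_sub_x0 hV hj hq

/-- **One full sub-step of transport**: across sub-step `u` the derivative witness is mapped by the
variational polynomial up to a defect of size `(RemV + defect) · wn (D σ (Tn u))`. [folklore] -/
theorem segDeriv_step (hj : j ≤ cd.N₀) (hV : cd.Valid) (hF : IsFlowPackage cd φ) (hC : ChainEnclosure cd φ)
    (hq : InPoly cd j q)
    (hD : ∀ σ ∈ Icc (0:ℝ) 1, ∀ t ∈ Icc 0 (cd.Tn j (cd.S j)),
      HasDerivWithinAt (fun σ' => toVec cd (stAt φ j (seg cd j q σ') t)) (D σ t) (Icc 0 1) σ)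
    (hσ : σ ∈ Icc (0:ℝ) 1) {u : ℕ} (hu : u < cd.S j) :
    cd.InBall j (ofVec cd (D σ (cd.Tn j (u + 1))) - cd.Vap j u (cd.h j u) (ofVec cd (D σ (cd.Tn j u))))
      ((cd.RemV (cd.bb j) (cd.mC j u) (cd.h j u) +
        (1 / (1 - cd.bb j * (cd.mC j u + cd.ρO j u) * cd.h j u) ^ 2 - 1 / (1 - cd.bb j * cd.mC j u * cd.h j u) ^ 2)) *
        wn cd j (D σ (cd.Tn j u))) := by
  have hω := G3.omega_pos hV hj
  set T := cd.Tn j (cd.S j) with hTdef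
  set hh := cd.h j u with hhdef
  set K : ℝ := cd.RemV (cd.bb j) (cd.mC j u) hh +
    (1 / (1 - cd.bb j * (cd.mC j u + cd.ρO j u) * hh) ^ 2 - 1 / (1 - cd.bb j * cd.mC j u * hh) ^ 2) with hKdef
  have hTu : 0 ≤ cd.Tn j u := G3.Tn_nonneg hV hj hu.le
  have hTu1 : cd.Tn j (u + 1) = cd.Tn j u + hh := G3.Tn_succ hV hj hu
  have hTu1_le : cd.Tn j (u + 1) ≤ T := G3.Tn_mono hV hj (Nat.succ_le_of_lt hu) le_rfl
  have hh0 : 0 < hh := G3.h_pos hV hj hu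
  -- the node curve and the flow property
  have hsol : ∀ σ' ∈ Icc (0:ℝ) 1, SolvesOn cd φ j (seg cd j q σ') T := fun σ' hσ' =>
    (hC j hj _ (inPoly_seg (inPoly_x0 hV hj) hq hσ')).1
  have hshift : ∀ σ' ∈ Icc (0:ℝ) 1, stAt φ j (seg cd j q σ') (cd.Tn j (u + 1)) =
      stAt φ j (stAt φ j (seg cd j q σ') (cd.Tn j u)) hh := by
    intro σ' hσ'
    rw [hTu1]
    exact G3.stAt_shift hF hj (hsol σ' hσ') hTu ⟨hh0.le, by linarith⟩
  -- the CLM of the variational polynomial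
  set Lv := winCLM cd (cd.Vap j u hh) (G3.isLinearMap_Vap hV hj hu.le hh) with hLvdef
  -- the increment bound from the two-point clause (F5c)
  have hA := hD σ hσ (cd.Tn j (u + 1)) ⟨by linarith, hTu1_le⟩
  have hB := hD σ hσ (cd.Tn j u) ⟨hTu, by linarith⟩
  have hincr : ∀ᶠ σ' in 𝓝[Icc (0:ℝ) 1] σ, ∀ c,
      |(toVec cd (stAt φ j (seg cd j q σ') (cd.Tn j (u + 1))) - toVec cd (stAt φ j (seg cd j q σ) (cd.Tn j (u + 1))) -
        Lv (toVec cd (stAt φ j (seg cd j q σ') (cd.Tn j u)) - toVec cd (stAt φ j (seg cd j q σ) (cd.Tn j u)))) c| ≤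
        (K * wW cd j c) *
          wn cd j (toVec cd (stAt φ j (seg cd j q σ') (cd.Tn j u)) - toVec cd (stAt φ j (seg cd j q σ) (cd.Tn j u))) := by
    filter_upwards [self_mem_nhdsWithin] with σ' hσ'
    intro c
    set y := stAt φ j (seg cd j q σ') (cd.Tn j u) with hydef
    set y' := stAt φ j (seg cd j q σ) (cd.Tn j u) with hy'def
    have hy : cd.InBall j (y - cd.x j u) (cd.ρO j u) := node_inBall_ρO hV hj hC (inPoly_seg (inPoly_x0 hV hj) hq hσ') hu.le
    have hy' : cd.InBall j (y' - cd.x j u) (cd.ρO j u) := node_inBall_ρO hV hj hC (inPoly_seg (inPoly_x0 hV hj) hq hσ) hu.le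
    have hws : cd.Wsupp (y - y') := G3.wsupp_stAt_sub hF hj _ _ _ _
    have hdd : cd.InBall j (y - y') (wn cd j (toVec cd (y - y'))) := inBall_wn_toVec hω _
    have h5 := ((hF j hj).2.2.2.2.2 u hu).2.2 y y' _ hy hy' hdd hws hh ⟨hh0.le, le_rfl⟩
    rw [← hshift σ' hσ', ← hshift σ hσ] at h5
    have h5c := (inBall_iff_toVec cd j _ _).1 h5 c
    have hLv : Lv (toVec cd y - toVec cd y') = toVec cd (cd.Vap j u hh (y - y')) := by
      rw [← toVec_sub, hLvdef, winCLM_apply, ofVec_toVec_of_wsupp cd hws]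
    rw [hLv, ← toVec_sub, ← toVec_sub, ← toVec_sub]
    calc |toVec cd (stAt φ j (seg cd j q σ') (cd.Tn j (u + 1)) - stAt φ j (seg cd j q σ) (cd.Tn j (u + 1)) -
            cd.Vap j u hh (y - y')) c| ≤ K * wn cd j (toVec cd (y - y')) * wW cd j c := h5c
      _ = K * wW cd j c * wn cd j (toVec cd (y - y')) := by ring
  -- pass to the limit
  have hlim := deriv_bound_of_increment_bound hσ hA hB Lv (continuous_wn j) (wn_smul j) (fun c => K * wW cd j c) hincr
  -- read back as a window ball
  have hws2 : cd.Wsupp (cd.Vap j u hh (ofVec cd (D σ (cd.Tn j u)))) := G3.wsupp_Vap hV hj hu.le _ _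
  rw [inBall_iff_toVec]
  intro c
  have h := hlim c
  have e : toVec cd (ofVec cd (D σ (cd.Tn j (u + 1))) - cd.Vap j u hh (ofVec cd (D σ (cd.Tn j u)))) =
      D σ (cd.Tn j (u + 1)) - Lv (D σ (cd.Tn j u)) := by
    rw [toVec_sub, toVec_ofVec, hLvdef, winCLM_apply]
  rw [e]
  calc |(D σ (cd.Tn j (u + 1)) - Lv (D σ (cd.Tn j u))) c| ≤ K * wW cd j c * wn cd j (D σ (cd.Tn j u)) := h
    _ = K * wn cd j (D σ (cd.Tn j u)) * wW cd j c := by ring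

/-- The per-sub-step transport defect constant `RemV + defect` is nonnegative. [folklore] -/
theorem stepDefect_nonneg (hj : j ≤ cd.N₀) (hV : cd.Valid) {u : ℕ} (hu : u < cd.S j) :
    0 ≤ cd.RemV (cd.bb j) (cd.mC j u) (cd.h j u) +
      (1 / (1 - cd.bb j * (cd.mC j u + cd.ρO j u) * cd.h j u) ^ 2 - 1 / (1 - cd.bb j * cd.mC j u * cd.h j u) ^ 2) := by
  have hbb := G3.bb_nonneg hV hj
  have hmC := mC_nonneg hV hj hu.le
  have hh := (G3.h_pos hV hj hu).le
  have hρO : 0 ≤ cd.ρO j u :=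
    (EI_nonneg hV hj hu.le).trans (((EI_le_E hV hj hu.le).trans (E_le_EO hV hj hu.le)).trans (EO_le_ρO hV hj hu.le))
  refine add_nonneg (RemV_nonneg cd hbb hmC hh (guard_mC hV hj hu)) (defect_nonneg ?_ (guard_ρO hV hj hu))
  have : cd.bb j * cd.mC j u * cd.h j u ≤ cd.bb j * (cd.mC j u + cd.ρO j u) * cd.h j u := by
    have h1 : 0 ≤ cd.bb j * cd.ρO j u * cd.h j u := by positivity
    nlinarith
  exact this

end Deriv

end Summit.NavierStokesRegularity.NavierStokesRegularity.Theorems.TaylorModelReadout.G4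

end
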